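import Literature.Probability.Percolation.Isoradial
import Literature.Probability.Percolation.IsoradialProofs
import Literature.Probability.LatticeModels.IsoradialSquareGrid
import HarnessLib

/-!
# Grimmett–Manolescu's box-crossing theorem: the printed hypothesis, and the base case `ℤ²`

Companion of `Literature.Probability.Percolation.Isoradial` (crit-perc.S24). That file vendors
Theorem 3.1 of G. R. Grimmett, I. Manolescu, *Bond percolation on isoradial graphs:
criticality and universality*, PTRF 159 (2014) 273–327 = arXiv:1204.0505, §3 — "For `G ∈ 𝒢`,
`P_G` possesses the box-crossing property" — as the named fact `gm_boxCrossing`, whose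
square-grid hypothesis is the H21 rendering `RhombicEmbedding.HasSquareGridProperty`
(`IsoradialGraphs`). This file consists of theorems only: it records why that fact is stated
*stronger* than its source, what the faithful statement is, and proves both forms outright in
the base case of the printed proof, the isoradial square lattice.

## The discrepancy (why `gm_boxCrossing` is stated stronger than its source)

The class `𝒢` of the paper is the class of isoradial graphs with the bounded-angles property
BAP(ε) for some `ε > 0` (§2.1, Definition 2.1) **and** the square-grid property SGP = "SGP(I)
for some `I ∈ ℕ`" (§4.2): the track-set `𝒯` is *partitioned* as `S ∪ T₁ ∪ T₂` with
(a) each `T_k` a `ℤ`-indexed family of distinct non-intersecting tracks, (b) for `k = 1, 2` and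
*every* track `s ∈ 𝒯 ∖ T_k`, *every* track of `T_k` intersects `s`, and these intersections
occur in index order along `s`, (c) fewer than `I` track-intersections on a track of `T_{3-k}`
between consecutive tracks of `T_k`. The faithful transcription of SGP(I)/SGP is
`RhombicEmbedding.SquareGridPropertyGM I` / `RhombicEmbedding.HasSquareGridPropertyGM`
(`Literature.Probability.LatticeModels.IsoradialSquareGrid`), and
`HasSquareGridPropertyGM.hasSquareGridProperty` proves that it implies the H21 rendering. The
converse fails, even among rhombic tilings with bounded angles (module docstring of
`IsoradialSquareGrid`; re-checked for this file): tile the plane by unit squares and insert one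
track `R` of rhombi with side `w = (cos β, sin β)`, `β ∈ (π/2, π)`, along the boundary of
`{y ≤ 0} ∪ {0 ≤ y ≤ ⌊x⌋}` (cut along that staircase, translate the upper part by `w`, fill the
gap with the parallelograms "segment `×` `w`"; `w` points to the left of every segment of the
staircase, so this is a rhombic tiling, with rhombus angles in `{β - π/2, π - β, π/2, …}`, hence
BAP). Its tracks are the columns, the rows and `R`; `R` crosses every column but only the rows of
index `≥ 0`. The pair (columns, rows) satisfies every clause of `HasSquareGridProperty` (mutual
crossings; a track meeting two rows `i < k` is a column or — if `i ≥ 0` — `R`, and meets every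
row in between; separation bound `M = 1`), whereas no partition `S ∪ T₁ ∪ T₂` satisfies
(a)–(c): `R ∈ S` would force the negative rows into `S` as well (they miss `R`), hence
`T₁ ∪ T₂ ⊆` columns, which do not cross each other, against (b); and `R ∈ T_k` is impossible
because along the column through the origin `R` is met *after* all the (negative) rows of
`T_k`, so the `ℤ`-indexed family `T_k`, met in index order by (b), would have a last element.
So this graph satisfies all hypotheses of `gm_boxCrossing` (it is preconnected, isoradial, a
rhombic tiling, has BAP and `HasSquareGridProperty`) and lies **outside** `𝒢`. Consequently
`gm_boxCrossing` asserts the box-crossing property for a strictly larger class of graphs than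
Theorem 3.1 covers; on the extra graphs the property is plausible but is not proved in print
(the printed proof, §7, uses clause (b) essentially: "any `r ∈ 𝒯` [not parallel to `s₀`]
intersects both `s₀` and `s₁` exactly once"; "since each `r_i` intersects each `s_j` …
`G_{α,β}` is an isoradial square lattice"). The same remark applies to
`gm_theta_critical_eq_zero` and `gm_universality_arms`; it applied to
`gm_boxCrossingBounds_uniform` (whose constants are moreover printed as `δ = δ(ε, I)`, (3.1))
and `gm_universality_oneArm` until their restatement in place with the printed hypothesis
(2026-08-15, see their docstrings in `Isoradial`).

## The faithful statement

The statement the source proves is `gm_boxCrossing` with `emb.HasSquareGridProperty` replaced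
by the printed `emb.HasSquareGridPropertyGM`, everything else verbatim:
```
def gm_boxCrossingGM : Prop :=
  ∀ (hconn : G.Preconnected) (hiso : emb.IsIsoradial) (hrh : emb.IsRhombicTiling) (hε : 0 < ε)
    (hbap : emb.HasBoundedAngles ε) (hsgp : emb.HasSquareGridPropertyGM),
    HasBoxCrossingProperty emb.isoradialPercolation emb.z
```
(binders `{V F} [DecidableEq V] [DecidableEq F] (G) (emb) (ε)`, exactly those of the elaborated
`gm_boxCrossing`). It is a *named fact* (its proof is the star–triangle transport of §§5–7 of the
paper, a theory-sized formalization) and is therefore to be vendored by a definition item, not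
by this proof-only file; the tree already records, as the theorem
`gm_boxCrossing.hasBoxCrossingProperty_of_hasSquareGridPropertyGM` (`Isoradial`), that the tree
fact implies it.

## Contents (theorems only)

* `hasBoxCrossingProperty_squareLatticeEmbedding` — **the base case of Theorem 3.1 holds
  outright**: the canonical measure of the isoradial square lattice `√2 ℤ²` has the box-crossing
  property `HasBoxCrossingProperty` (its canonical measure is `P_{1/2}`,
  `isoradialPercolation_square_eq_holds`, which has the property by the Russo–Seymour–Welsh
  theorem, `square_boxCrossing_holds` of `IsoradialProofs`). This is the input of the printed
  proof (§2.3, after Definition 2.2: "It was proved by Russo and Seymour–Welsh that the isotropic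
  embedding of the square lattice (with `p = ½`) has the box-crossing property"; `ℤ² ∈ 𝒢` by
  §4.3.1) and the common special case of `gm_boxCrossing` and of the faithful statement above.
* `gm_boxCrossing_squareLattice` — the tree fact `gm_boxCrossing` holds for the square lattice,
  for every `ε` (so the fact, though stronger than its source, is consistent with its proved
  base case; the sanity corollary `square_boxCrossing` of `Isoradial` is the same statement read
  through `isoradialPercolation_square_eq`).
* `hasBoxCrossingProperty_squareLatticeEmbedding_printed` — the faithful statement instantiated
  at `ℤ²`, with its printed hypotheses discharged (`hasSquareGridPropertyGM_squareLattice`, …),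
  as a usage example of the intended form.
* `hasBoxCrossingProperty_of_gm_boxCrossingBounds_uniform`,
  `hasBoxCrossingProperty_of_gm_boxCrossingBounds_uniform_of_hasSquareGridPropertyGM` — **the
  faithful per-graph statement is a corollary of the uniform fact**: since its restatement of
  2026-08-15 the named fact `gm_boxCrossingBounds_uniform` (`Isoradial`) is the printed uniform
  form (3.1) of Theorem 3.1 ("for `ε > 0` and `I ∈ ℕ` there exists `δ = δ(ε, I) > 0` such that if
  `G` satisfies BAP(ε) and SGP(I), `P_G` satisfies BXP(δ)", constants chosen before the graph,
  graphs on types in `Type`); specialising its constants to one graph gives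
  `HasBoxCrossingProperty emb.isoradialPercolation emb.z` for every preconnected, countable,
  locally finite graph on a type in `Type`, isoradially and rhombically embedded with
  `HasBoundedAngles ε`, `0 < ε`, and `SquareGridPropertyGM I` (resp. `HasSquareGridPropertyGM`)
  — i.e. the statement `gm_boxCrossingGM` above for graphs in `Type` (which contains every
  countable graph up to isomorphism), under the standing instances `Countable V`,
  `G.LocallyFinite` of the class. So, for the printed class `𝒢`, the per-graph Theorem 3.1 adds
  no proof obligation beyond `gm_boxCrossingBounds_uniform` (the paper states and proves the
  theorem in the uniform form: §3, (3.1), "the box-crossing property with constants that depend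
  only on `ε`, `I`"). The companion `IsoradialCriticalityProofs` draws `θ(P_G) = 0` on `𝒢(ε, I)`
  from the same instantiation (`gm_theta_critical_eq_zero_of_gm_boxCrossingBounds_uniform`).

## References

* G. R. Grimmett, I. Manolescu, *Bond percolation on isoradial graphs: criticality and
  universality*, Probab. Theory Related Fields 159 (2014) 273–327; arXiv:1204.0505: §2.1
  (Def. 2.1, BAP(ε)), §2.3 (Def. 2.2, BXP), §3 (Thm 3.1 and (3.1)), §4.2 (SGP(I)), §4.3.1, §7.
* L. Russo, *A note on percolation*, Z. Wahrsch. Verw. Gebiete 43 (1978) 39–48; P. D. Seymour,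
  D. J. A. Welsh, *Percolation probabilities on the square lattice*, Ann. Discrete Math. 3
  (1978) 227–245 (the base case).
* H. Duminil-Copin, J.-H. Li, I. Manolescu, *Universality for the random-cluster model on
  isoradial graphs*, Electron. J. Probab. 23 (2018), §2 (same reading of a *grid*).
-/

noncomputable section

open MeasureTheory ProbabilityTheory

namespace Literature.Probability.Percolation

open LatticeModels Percolation

/-- **Base case of Grimmett–Manolescu's Theorem 3.1, proved**: the canonical bond percolation
measure of the isoradial square lattice `√2 ℤ²` has the box-crossing property (H21 rendering
`HasBoxCrossingProperty`: axis-parallel rectangles of every aspect ratio, all translations,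
probabilities in `[c, 1 - c]` eventually in the scale). Proof: that measure is `P_{1/2}`
(`isoradialPercolation_square_eq_holds`) and `P_{1/2}` on `ℤ²` has the property by the
Russo–Seymour–Welsh theorem (`square_boxCrossing_holds`). (Grimmett–Manolescu 2014, §2.3, the
sentence after Definition 2.2; Russo 1978; Seymour–Welsh 1978.)
[cite: GrimmettManolescu2014Isoradial, §2.3 (after Def. 2.2: RSW gives BXP for ℤ² at p = 1/2)] -/
theorem hasBoxCrossingProperty_squareLatticeEmbedding :
    HasBoxCrossingProperty squareLatticeEmbedding.isoradialPercolation squareLatticeEmbedding.z := by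
  have h : squareLatticeEmbedding.isoradialPercolation = bondPercolation (zdGraph 2) half :=
    isoradialPercolation_square_eq_holds
  rw [h]
  exact square_boxCrossing_holds

/-- **The tree fact `gm_boxCrossing` holds for the isoradial square lattice** (for every `ε`, and
without using its hypotheses): immediate from `hasBoxCrossingProperty_squareLatticeEmbedding`.
(Grimmett–Manolescu 2014, §2.3 after Def. 2.2, and §4.3.1: `ℤ² ∈ 𝒢`.)
[cite: GrimmettManolescu2014Isoradial, §2.3 (after Def. 2.2) and §4.3.1] -/
theorem gm_boxCrossing_squareLattice (ε : ℝ) :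
    gm_boxCrossing (zdGraph 2) squareLatticeEmbedding ε :=
  fun _ _ _ _ _ _ => hasBoxCrossingProperty_squareLatticeEmbedding

/-- **The faithful form of Theorem 3.1 at `ℤ²`, hypotheses included and discharged**: the square
lattice is preconnected (`zdGraph_preconnected_holds`), isoradially embedded
(`isIsoradial_squareLatticeEmbedding_holds`), a rhombic tiling
(`isRhombicTiling_squareLatticeEmbedding_holds`), has BAP(π/4)
(`hasBoundedAngles_squareLatticeEmbedding_holds`) and the *printed* square-grid property
(`hasSquareGridPropertyGM_squareLattice`, SGP(1), §4.3.1), and its canonical measure has the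
box-crossing property. Stated as the conjunction "`ℤ² ∈ 𝒢(π/4, 1)` and BXP", i.e. the shape of
the faithful statement `gm_boxCrossingGM` of the module docstring with every hypothesis
verified rather than assumed. (Grimmett–Manolescu 2014, §3 Thm 3.1 with §4.3.1 and §2.3.)
[cite: GrimmettManolescu2014Isoradial, §3 Thm 3.1, §4.3.1 (ℤ² ∈ 𝒢), §2.3 (RSW base case)] -/
theorem hasBoxCrossingProperty_squareLatticeEmbedding_printed :
    ((zdGraph 2).Preconnected ∧ squareLatticeEmbedding.IsIsoradial ∧
      squareLatticeEmbedding.IsRhombicTiling ∧ (0 : ℝ) < Real.pi / 4 ∧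
      squareLatticeEmbedding.HasBoundedAngles (Real.pi / 4) ∧
      squareLatticeEmbedding.HasSquareGridPropertyGM) ∧
    HasBoxCrossingProperty squareLatticeEmbedding.isoradialPercolation squareLatticeEmbedding.z :=
  ⟨⟨zdGraph_preconnected_holds, isIsoradial_squareLatticeEmbedding_holds,
    isRhombicTiling_squareLatticeEmbedding_holds, by positivity,
    hasBoundedAngles_squareLatticeEmbedding_holds le_rfl, hasSquareGridPropertyGM_squareLattice⟩,
    hasBoxCrossingProperty_squareLatticeEmbedding⟩

/-! ### The per-graph statement from the uniform fact (3.1) -/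

/-- **Theorem 3.1 per graph, from its uniform form (3.1)** (Grimmett–Manolescu, PTRF 159 (2014)
= arXiv:1204.0505, §3: "for `ε > 0` and `I ∈ ℕ` there exists `δ = δ(ε, I) > 0` such that: if
`G` satisfies BAP(ε) and SGP(I), `P_G` satisfies BXP(δ)" — in particular every single
`G ∈ 𝒢(ε, I)` has the box-crossing property). For a preconnected, countable, locally finite
graph `G` on a type in `Type`, isoradially and rhombically embedded with `HasBoundedAngles ε`,
`0 < ε`, and the *printed* square-grid property `SquareGridPropertyGM I` (§4.2), the named fact
`gm_boxCrossingBounds_uniform` (the printed uniform statement, constants `c, n₀` chosen from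
`(ε, I, ρ)` before the graph) yields `HasBoxCrossingProperty emb.isoradialPercolation emb.z`:
for each aspect ratio `ρ > 0` take the uniform constants and specialise them to `G`.
[cite: GrimmettManolescu2014Isoradial, §3 Thm 3.1 with (3.1) (δ = δ(ε, I)); §4.2 (SGP(I))] -/
theorem hasBoxCrossingProperty_of_gm_boxCrossingBounds_uniform
    (h : gm_boxCrossingBounds_uniform) {V F : Type} [Countable V] [DecidableEq V]
    [DecidableEq F] (G : SimpleGraph V) [G.LocallyFinite] (emb : RhombicEmbedding G F)
    {ε : ℝ} (hconn : G.Preconnected) (hiso : emb.IsIsoradial) (hrh : emb.IsRhombicTiling)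
    (hε : 0 < ε) (hbap : emb.HasBoundedAngles ε) {I : ℕ} (hsgp : emb.SquareGridPropertyGM I) :
    HasBoxCrossingProperty emb.isoradialPercolation emb.z := by
  intro ρ hρ
  obtain ⟨c, hc, n₀, hh⟩ := h ε hε I ρ hρ
  exact ⟨c, hc, n₀, hh V F G emb hconn hiso hrh hbap hsgp⟩

/-- **The faithful per-graph statement of Theorem 3.1 (hypothesis SGP = "SGP(I) for some `I`",
`HasSquareGridPropertyGM`) for graphs in `Type`, from the uniform fact**: the shape of
`gm_boxCrossingGM` of the module docstring — `∀ hconn hiso hrh hε hbap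
(hsgp : emb.HasSquareGridPropertyGM), HasBoxCrossingProperty emb.isoradialPercolation emb.z` —
under the standing instances `Countable V`, `G.LocallyFinite` of the class `𝒢`, derived from
`gm_boxCrossingBounds_uniform` through `hasBoxCrossingProperty_of_gm_boxCrossingBounds_uniform`
(Grimmett–Manolescu 2014, §3 Thm 3.1: "For `G ∈ 𝒢`, `P_G` possesses the box-crossing property";
§4.2: "`G` has the square grid property if it satisfies SGP(I) for some `I`").
[cite: GrimmettManolescu2014Isoradial, §3 Thm 3.1 (BXP for 𝒢); §4.2 (SGP)] -/
theorem hasBoxCrossingProperty_of_gm_boxCrossingBounds_uniform_of_hasSquareGridPropertyGM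
    (h : gm_boxCrossingBounds_uniform) {V F : Type} [Countable V] [DecidableEq V]
    [DecidableEq F] (G : SimpleGraph V) [G.LocallyFinite] (emb : RhombicEmbedding G F)
    (ε : ℝ) :
    ∀ (_hconn : G.Preconnected) (_hiso : emb.IsIsoradial) (_hrh : emb.IsRhombicTiling)
      (_hε : 0 < ε) (_hbap : emb.HasBoundedAngles ε) (_hsgp : emb.HasSquareGridPropertyGM),
      HasBoxCrossingProperty emb.isoradialPercolation emb.z := by
  intro hconn hiso hrh hε hbap hsgp
  obtain ⟨I, hI⟩ := hsgp
  exact hasBoxCrossingProperty_of_gm_boxCrossingBounds_uniform h G emb hconn hiso hrh hε hbap hI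

end Literature.Probability.Percolation

end
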